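import Mathlib
import Literature.MathematicalPhysics.QuantumFieldTheory.BalabanImbrieJaffe1984to88.BIJ88Sect4Statements
import Literature.MathematicalPhysics.QuantumFieldTheory.BalabanImbrieJaffe1984to88.BIJ88Sect5Statements

/-!
# `BalabanImbrieJaffe1984to88.BIJ88PkDerivatives` — T. Bałaban, J. Imbrie, A. Jaffe, *Effective action and cluster
properties of the abelian Higgs model*, Commun. Math. Phys. **114** (1988) 257–315 [BalabanImbrieJaffe1988]: Sect. 4
"The Inductive Hypothesis", displays (4.14)–(4.15) p. 276 — the derivatives `P_k^{(l)}` of the dominant scalar term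
`P_k(φ) = λ_k|φ|⁴ − ¼(L^kε)²|φ|² + (1/64λ)(L^kε)^d` as a real-smooth function of the complex field value: MASTER BOUNDS
(file 1 of 2 of the proof of (4.15); file 2 = `BIJ88Ineq415Proof`)

statement-level skeleton of published theorems with citation tags; proofs where landed; nothing here is a
claim about the Yang–Mills mass gap

PDF held: `paper:balaban1988-cmp114-bij-abelian-higgs-effective-action` (journal page = PDF page + 256).  The display (4.15)
is lost in the text layer of the scan (PDF p. 20); it is quoted from the C2 §§1–4 owner's transcription of the page image
(`BIJ88Sect4Statements.Ineq415`, unit `lit-balaban-r18`, row C2.Eq4.15 of `HOME/lit-balaban-r18/ROWS-C2.md` — the row of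
record); the surrounding sentences of p. 276 are legible in the text layer and agree.

CITATION HEADER (lean-in-tree rule).  lit-balaban TYPED SKELETON, PHASE 2 (HOME `run/shared/lean/pub/lit-balaban/`); proof
seat p27, generation 3 (unit `lit-balaban-p27`; TAKING line HOME/STATUS.md 2026-08-21T02:56:28Z); row owner `lit-balaban-r18`;
referee group ref-5.  WHAT IS REPRODUCED: support for SKELETON row **C2.Eq4.15** — verbatim p. 276 [PDF 20]: *"The dominant
term for the scalar field is P_k(φ_k), where P_k(φ) = λ_k|φ|⁴ − ¼(L^kε)²|φ|² + (1/64λ)(L^kε)^d. (4.14)  Under the restrictions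
in χ_k, |P_k(φ_k)| ≦ cp(e_k)⁴. At P_k-vertices with l external legs, we have its l-th derivative |P_k^{(l)}(φ_k)| ≦
cλ_k^{l/4}p(e_k)^{4−l}, for (L^kε)^d ≦ λ, |P_k^{(l)}(φ_k)| ≦ c(L^kε)^l p(e_k)^{4−l}, for (L^kε)^d > λ. (4.15)"*.
The `l`-th derivative of `P_k : ℂ → ℝ` (kind «model-instance»: the `l`-th real Fréchet derivative `iteratedFDeriv ℝ l`, a
symmetric `l`-linear form on field increments — the vertex with `l` external legs — measured in operator norm) is BOUNDED here in
closed form; file 2 feeds the restrictions (4.5) into these bounds.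

THE PROOF (ours; the paper states (4.15) without proof).  With `s = L^kε`, `λ_k = s^{4−d}λ` ((2.2), `BIJ88Sect5Statements.lamK`,
r16) and `ρ₀² = s^{d−2}/(8λ)` ((5.2.5), `BIJ88Sect5Statements.rho0`): `P_k(φ) = λ_k(|φ|² − ρ₀²)²` (`BIJ88Sect5Statements.Pk_eq_sq`;
`Pk_eq_quartic` below).  §1 (calculus kernel, any real inner product space, Mathlib `hasStrictFDerivAt_norm_sq`): `g(φ) = |φ|² − r`
has `‖Dg(φ)‖ = 2|φ|`, `‖D²g‖ ≤ 2`, `D^{n}g = 0` (`n ≥ 3`); the Leibniz bound (Mathlib `norm_iteratedFDeriv_mul_le`) for `a·g·g` then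
gives §2, the MASTER BOUNDS: `‖P_k^{(0)}(φ)‖ = λ_k(|φ|² − ρ₀²)²`, `‖P_k^{(1)}(φ)‖ ≤ 4λ_k||φ|² − ρ₀²||φ|`, `‖P_k^{(2)}(φ)‖ ≤
λ_k(4||φ|² − ρ₀²| + 8|φ|²)`, `‖P_k^{(3)}(φ)‖ ≤ 24λ_k|φ|`, `‖P_k^{(4)}(φ)‖ ≤ 24λ_k`, `P_k^{(l)} = 0` (`l ≥ 5`).  §3 (regime algebra):
`λ_k s^d = s⁴λ`, so `s^d ≤ λ ⟺ s⁴ ≤ λ_k`, `λ ≤ s^d ⟺ λ_k ≤ s⁴`, `s^d < L^dλ ⟹ s⁴ < L^dλ_k`; r18's ring radius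
`(8λ)^{−1/2}s^{(d−2)/2}` of (4.5) equals r16's `ρ₀`; `λ_kρ₀² = s²/8` gives `λ_kρ₀ ≤ 3s³/8` when `λ_k ≤ s⁴`.

WHAT IS TYPED AND PROVED (theorems only; no `def`; all `d`, `λ > 0`, `s = L^kε > 0`): `Pk_eq_quartic`, `lamK_pos`,
`norm_iteratedFDeriv_Pk_zero`, `norm_iteratedFDeriv_Pk_one_le`, `norm_iteratedFDeriv_Pk_two_le`, `norm_iteratedFDeriv_Pk_three_le`,
`norm_iteratedFDeriv_Pk_four_le`, `iteratedFDeriv_Pk_eq_zero`; `lamK_mul_pow`, `pow_le_iff_pow_four_le_lamK`,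
`le_pow_iff_lamK_le_pow_four`, `lt_pow_iff_lamK_lt_pow_four`, `pow_four_lt_of_smallField`, `ringRadius_eq_rho0`, `lamK_mul_rho0_le`.
NOT ASSERTED: anything beyond these kernel facts; (4.15) itself is `BIJ88Ineq415Proof.ineq415_of_restr45`.  No `sorry`; axioms
⊆ {propext, Classical.choice, Quot.sound}.
-/

namespace Literature.MathematicalPhysics.QuantumFieldTheory.BalabanImbrieJaffe1984to88.BIJ88PkDerivatives

open BIJ88Sect5Statements (lamK rho0 lamK_mul_rho0_sq rho0_sq)
open scoped BigOperators

noncomputable section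

/-! ## §1. Calculus kernel: derivatives of `φ ↦ |φ|² − r` and of `φ ↦ a(|φ|² − r)²` on a real inner product space -/

section calculus

variable {F : Type*} [NormedAddCommGroup F] [InnerProductSpace ℝ F]

/-- kernel: the real inner product as an honest `ℝ`-bilinear continuous map (Mathlib's `innerSL ℝ` is typed
conjugate-linear in the first slot; over `ℝ` the two types coincide), applied: `⟨x, ·⟩` has operator norm `‖x‖`. [folklore] -/
private theorem norm_innerSLR_apply (x : F) : ‖(innerSL ℝ : F →L[ℝ] F →L[ℝ] ℝ) x‖ = ‖x‖ :=
  innerSL_apply_norm ℝ x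

/-- kernel: `‖2⟨x, ·⟩‖ = 2‖x‖`. [folklore] -/
private theorem norm_two_smul_innerSLR_apply (x : F) :
    ‖((2 : ℝ) • (innerSL ℝ : F →L[ℝ] F →L[ℝ] ℝ)) x‖ = 2 * ‖x‖ := by
  show ‖(2 : ℝ) • ((innerSL ℝ : F →L[ℝ] F →L[ℝ] ℝ) x)‖ = 2 * ‖x‖
  rw [norm_smul, Real.norm_two, norm_innerSLR_apply]

/-- kernel: the bilinear map `2⟨·, ·⟩` has operator norm `≤ 2`. [folklore] -/
private theorem norm_two_smul_innerSLR_le : ‖((2 : ℝ) • (innerSL ℝ : F →L[ℝ] F →L[ℝ] ℝ))‖ ≤ 2 :=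
  ContinuousLinearMap.opNorm_le_bound _ (by norm_num) fun x => by rw [norm_two_smul_innerSLR_apply]

/-- kernel: `D(|x|² − r) = 2⟨x, ·⟩` (Mathlib `hasStrictFDerivAt_norm_sq`). [folklore] -/
private theorem hasFDerivAt_normSq_sub (r : ℝ) (x : F) :
    HasFDerivAt (fun y : F => ‖y‖ ^ 2 - r) (((2 : ℝ) • (innerSL ℝ : F →L[ℝ] F →L[ℝ] ℝ)) x) x := by
  refine ((hasStrictFDerivAt_norm_sq x).hasFDerivAt.sub_const r).congr_fderiv ?_
  show (2 : ℕ) • innerSL ℝ x = (2 : ℝ) • ((innerSL ℝ : F →L[ℝ] F →L[ℝ] ℝ) x)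
  rw [ofNat_smul_eq_nsmul (R := ℝ) 2 ((innerSL ℝ : F →L[ℝ] F →L[ℝ] ℝ) x)]

/-- kernel: the first derivative of `|x|² − r` as a function. [folklore] -/
private theorem fderiv_normSq_sub (r : ℝ) :
    fderiv ℝ (fun y : F => ‖y‖ ^ 2 - r) = fun x => ((2 : ℝ) • (innerSL ℝ : F →L[ℝ] F →L[ℝ] ℝ)) x := by
  funext x
  exact (hasFDerivAt_normSq_sub r x).fderiv

/-- kernel: the second derivative of `|x|² − r` is the constant bilinear map `2⟨·, ·⟩`. [folklore] -/
private theorem fderiv_fderiv_normSq_sub (r : ℝ) :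
    fderiv ℝ (fderiv ℝ (fun y : F => ‖y‖ ^ 2 - r)) = fun _ => ((2 : ℝ) • (innerSL ℝ : F →L[ℝ] F →L[ℝ] ℝ)) := by
  rw [fderiv_normSq_sub]
  funext x
  exact ContinuousLinearMap.fderiv _

/-- kernel: `|x|² − r` is smooth. [folklore] -/
private theorem contDiff_normSq_sub (r : ℝ) {n : WithTop ℕ∞} : ContDiff ℝ n (fun y : F => ‖y‖ ^ 2 - r) :=
  (contDiff_norm_sq ℝ).sub contDiff_const

/-- kernel: `‖D⁰(|x|² − r)‖ = ||x|² − r|`. [folklore] -/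
private theorem norm_iteratedFDeriv_zero_normSq_sub (r : ℝ) (x : F) :
    ‖iteratedFDeriv ℝ 0 (fun y : F => ‖y‖ ^ 2 - r) x‖ = |‖x‖ ^ 2 - r| := by
  rw [norm_iteratedFDeriv_zero, Real.norm_eq_abs]

/-- kernel: `‖D¹(|x|² − r)‖ = 2‖x‖`. [folklore] -/
private theorem norm_iteratedFDeriv_one_normSq_sub (r : ℝ) (x : F) :
    ‖iteratedFDeriv ℝ 1 (fun y : F => ‖y‖ ^ 2 - r) x‖ = 2 * ‖x‖ := by
  rw [← norm_iteratedFDeriv_fderiv, norm_iteratedFDeriv_zero, fderiv_normSq_sub, norm_two_smul_innerSLR_apply]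

/-- kernel: `‖D²(|x|² − r)‖ ≤ 2`. [folklore] -/
private theorem norm_iteratedFDeriv_two_normSq_sub (r : ℝ) (x : F) :
    ‖iteratedFDeriv ℝ 2 (fun y : F => ‖y‖ ^ 2 - r) x‖ ≤ 2 := by
  rw [← norm_iteratedFDeriv_fderiv, ← norm_iteratedFDeriv_fderiv, norm_iteratedFDeriv_zero, fderiv_fderiv_normSq_sub]
  exact norm_two_smul_innerSLR_le

/-- kernel: `D^{n}(|x|² − r) = 0` for `n ≥ 3`. [folklore] -/
private theorem norm_iteratedFDeriv_normSq_sub_of_three_le (r : ℝ) (x : F) {n : ℕ} (hn : 3 ≤ n) :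
    ‖iteratedFDeriv ℝ n (fun y : F => ‖y‖ ^ 2 - r) x‖ = 0 := by
  obtain ⟨m, rfl⟩ := Nat.exists_eq_add_of_le' hn
  rw [← norm_iteratedFDeriv_fderiv, ← norm_iteratedFDeriv_fderiv, fderiv_fderiv_normSq_sub,
    iteratedFDeriv_const_of_ne (by omega)]
  simp

/-- kernel (Leibniz): for `Q(x) = a·(|x|² − r)·(|x|² − r)`,
`‖D^{n}Q(x)‖ ≤ |a| Σ_{i ≤ n} C(n,i) ‖D^{i}(|x|² − r)‖ ‖D^{n−i}(|x|² − r)‖` (Mathlib `norm_iteratedFDeriv_mul_le`). [folklore] -/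
private theorem norm_iteratedFDeriv_quartic_le (a r : ℝ) (x : F) (n : ℕ) :
    ‖iteratedFDeriv ℝ n (fun y : F => a * ((‖y‖ ^ 2 - r) * (‖y‖ ^ 2 - r))) x‖ ≤
      |a| * ∑ i ∈ Finset.range (n + 1), (n.choose i : ℝ) * ‖iteratedFDeriv ℝ i (fun y : F => ‖y‖ ^ 2 - r) x‖ *
        ‖iteratedFDeriv ℝ (n - i) (fun y : F => ‖y‖ ^ 2 - r) x‖ := by
  have hg : ContDiff ℝ (⊤ : WithTop ℕ∞) (fun y : F => ‖y‖ ^ 2 - r) := contDiff_normSq_sub r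
  have h1 : iteratedFDeriv ℝ n (fun y : F => a * ((‖y‖ ^ 2 - r) * (‖y‖ ^ 2 - r))) x =
      a • iteratedFDeriv ℝ n (fun y : F => (‖y‖ ^ 2 - r) * (‖y‖ ^ 2 - r)) x :=
    iteratedFDeriv_const_smul_apply' (f := fun y : F => (‖y‖ ^ 2 - r) * (‖y‖ ^ 2 - r)) (a := a)
      ((hg.mul hg).contDiffAt.of_le le_top)
  rw [h1, norm_smul, Real.norm_eq_abs]
  gcongr
  exact norm_iteratedFDeriv_mul_le hg hg x le_top

/-- kernel (the Leibniz sums for a factor with `‖D⁰‖ = G`, `‖D¹‖ = 2M`, `‖D²‖ ≤ 2`, `D^{n} = 0` for `n ≥ 3`):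
`Σ C(1,i)D_iD_{1−i} = 4GM`, `Σ C(2,i)D_iD_{2−i} ≤ 4G + 8M²`, `Σ C(3,i)… ≤ 24M`, `Σ C(4,i)… ≤ 24`, `Σ C(n,i)… = 0` (`n ≥ 5`). [folklore] -/
private theorem leibniz_sums (D : ℕ → ℝ) (G M : ℝ) (hG : 0 ≤ G) (hM : 0 ≤ M) (h0 : D 0 = G) (h1 : D 1 = 2 * M)
    (h2 : D 2 ≤ 2) (h2' : 0 ≤ D 2) (h3 : ∀ n, 3 ≤ n → D n = 0) :
    ∑ i ∈ Finset.range (1 + 1), (Nat.choose 1 i : ℝ) * D i * D (1 - i) = 4 * G * M ∧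
    ∑ i ∈ Finset.range (2 + 1), (Nat.choose 2 i : ℝ) * D i * D (2 - i) ≤ 4 * G + 8 * M ^ 2 ∧
    ∑ i ∈ Finset.range (3 + 1), (Nat.choose 3 i : ℝ) * D i * D (3 - i) ≤ 24 * M ∧
    ∑ i ∈ Finset.range (4 + 1), (Nat.choose 4 i : ℝ) * D i * D (4 - i) ≤ 24 ∧
    ∀ n, 5 ≤ n → ∑ i ∈ Finset.range (n + 1), (Nat.choose n i : ℝ) * D i * D (n - i) = 0 := by
  have c32 : Nat.choose 3 2 = 3 := by decide
  have c42 : Nat.choose 4 2 = 6 := by decide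
  have c43 : Nat.choose 4 3 = 4 := by decide
  have hD3 := h3 3 le_rfl
  have hD4 := h3 4 (by norm_num)
  refine ⟨?_, ?_, ?_, ?_, fun n hn => ?_⟩
  · simp only [Finset.sum_range_succ, Finset.sum_range_zero, Nat.choose_zero_right, Nat.choose_self, Nat.cast_one,
      Nat.sub_zero, Nat.sub_self, h0, h1]
    ring
  · simp only [Finset.sum_range_succ, Finset.sum_range_zero, Nat.choose_zero_right, Nat.choose_self,
      Nat.choose_one_right, Nat.cast_one, Nat.cast_ofNat, Nat.sub_zero, Nat.sub_self, Nat.add_one_sub_one, h0, h1]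
    nlinarith [mul_le_mul_of_nonneg_left h2 hG]
  · simp only [Finset.sum_range_succ, Finset.sum_range_zero, Nat.choose_zero_right, Nat.choose_self,
      Nat.choose_one_right, Nat.cast_one, Nat.cast_ofNat, Nat.sub_zero, Nat.sub_self, c32, h0, h1, hD3, Nat.reduceSub]
    nlinarith [mul_le_mul_of_nonneg_left h2 hM]
  · simp only [Finset.sum_range_succ, Finset.sum_range_zero, Nat.choose_zero_right, Nat.choose_self,
      Nat.choose_one_right, Nat.cast_one, Nat.cast_ofNat, Nat.sub_zero, Nat.sub_self, c42, c43, h0, h1, hD3, hD4,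
      Nat.reduceSub]
    nlinarith [mul_le_mul h2 h2 h2' zero_le_two]
  · refine Finset.sum_eq_zero fun i _ => ?_
    rcases le_or_gt 3 i with h | h
    · rw [h3 i h]; ring
    · rw [h3 (n - i) (by omega)]; ring

/-- kernel (the master bounds for the quartic `Q(x) = a·(|x|² − r)·(|x|² − r)`): `‖D⁰Q‖ = |a|(|x|² − r)²`,
`‖D¹Q‖ ≤ 4|a|·||x|² − r|·‖x‖`, `‖D²Q‖ ≤ |a|(4||x|² − r| + 8‖x‖²)`, `‖D³Q‖ ≤ 24|a|‖x‖`, `‖D⁴Q‖ ≤ 24|a|`, `D^{n}Q = 0` (`n ≥ 5`). [folklore] -/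
private theorem quartic_bounds (a r : ℝ) (x : F) :
    ‖iteratedFDeriv ℝ 0 (fun y : F => a * ((‖y‖ ^ 2 - r) * (‖y‖ ^ 2 - r))) x‖ = |a| * (‖x‖ ^ 2 - r) ^ 2 ∧
    ‖iteratedFDeriv ℝ 1 (fun y : F => a * ((‖y‖ ^ 2 - r) * (‖y‖ ^ 2 - r))) x‖ ≤ 4 * |a| * |‖x‖ ^ 2 - r| * ‖x‖ ∧
    ‖iteratedFDeriv ℝ 2 (fun y : F => a * ((‖y‖ ^ 2 - r) * (‖y‖ ^ 2 - r))) x‖ ≤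
      |a| * (4 * |‖x‖ ^ 2 - r| + 8 * ‖x‖ ^ 2) ∧
    ‖iteratedFDeriv ℝ 3 (fun y : F => a * ((‖y‖ ^ 2 - r) * (‖y‖ ^ 2 - r))) x‖ ≤ 24 * |a| * ‖x‖ ∧
    ‖iteratedFDeriv ℝ 4 (fun y : F => a * ((‖y‖ ^ 2 - r) * (‖y‖ ^ 2 - r))) x‖ ≤ 24 * |a| ∧
    ∀ n, 5 ≤ n → iteratedFDeriv ℝ n (fun y : F => a * ((‖y‖ ^ 2 - r) * (‖y‖ ^ 2 - r))) x = 0 := by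
  have ha : 0 ≤ |a| := abs_nonneg a
  obtain ⟨s1, s2, s3, s4, s5⟩ := leibniz_sums (fun i => ‖iteratedFDeriv ℝ i (fun y : F => ‖y‖ ^ 2 - r) x‖)
    |‖x‖ ^ 2 - r| ‖x‖ (abs_nonneg _) (norm_nonneg _) (norm_iteratedFDeriv_zero_normSq_sub r x)
    (norm_iteratedFDeriv_one_normSq_sub r x) (norm_iteratedFDeriv_two_normSq_sub r x) (norm_nonneg _)
    (fun n hn => norm_iteratedFDeriv_normSq_sub_of_three_le r x hn)
  refine ⟨?_, ?_, ?_, ?_, ?_, fun n hn => ?_⟩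
  · rw [norm_iteratedFDeriv_zero, Real.norm_eq_abs, abs_mul, ← pow_two, abs_pow, sq_abs]
  · refine (norm_iteratedFDeriv_quartic_le a r x 1).trans ?_
    rw [s1]; exact le_of_eq (by ring)
  · exact (norm_iteratedFDeriv_quartic_le a r x 2).trans (by gcongr)
  · refine (norm_iteratedFDeriv_quartic_le a r x 3).trans ?_
    calc |a| * _ ≤ |a| * (24 * ‖x‖) := by gcongr
      _ = 24 * |a| * ‖x‖ := by ring
  · refine (norm_iteratedFDeriv_quartic_le a r x 4).trans ?_
    calc |a| * _ ≤ |a| * 24 := by gcongr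
      _ = 24 * |a| := by ring
  · have h := norm_iteratedFDeriv_quartic_le a r x n
    rw [s5 n hn, mul_zero] at h
    exact norm_eq_zero.mp (le_antisymm h (norm_nonneg _))

end calculus

/-! ## §2. The master bounds for the dominant term (4.14): `P_k(φ) = λ_k(|φ|² − ρ₀²)²` on `ℂ` as a real inner product space -/

variable {lam s : ℝ}

/-- kernel: (4.14) as the quartic `φ ↦ λ_k·(|φ|² − ρ₀²)·(|φ|² − ρ₀²)` — the completed square (5.2.5)
(`BIJ88Sect5Statements.Pk_eq_sq`; the radial (5.2.5) typing `BIJ88Sect5Statements.Pk λ s d |φ|` is (4.14) at `λ_k = s^{4−d}λ`,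
r16's bridge `Pk_eq_Sect4`), as an equality of functions `ℂ → ℝ`. [cite: BalabanImbrieJaffe1988, (4.15) p.276] -/
theorem Pk_eq_quartic (hlam : 0 < lam) (hs : 0 < s) (d : ℕ) :
    (BIJ88Sect4Statements.Pk (lamK lam s d) s lam d : ℂ → ℝ) =
      fun z : ℂ => lamK lam s d * ((‖z‖ ^ 2 - rho0 lam s d ^ 2) * (‖z‖ ^ 2 - rho0 lam s d ^ 2)) := by
  funext z
  have h : BIJ88Sect4Statements.Pk (lamK lam s d) s lam d z = BIJ88Sect5Statements.Pk lam s d ‖z‖ := by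
    simp only [BIJ88Sect4Statements.Pk, BIJ88Sect5Statements.Pk]
  rw [h, BIJ88Sect5Statements.Pk_eq_sq hlam hs]
  ring

/-- kernel: `λ_k = s^{4−d}λ > 0` for `λ > 0`, `s = L^kε > 0`. [cite: BalabanImbrieJaffe1988, (4.15) p.276] -/
theorem lamK_pos (hlam : 0 < lam) (hs : 0 < s) (d : ℕ) : 0 < lamK lam s d := by
  unfold lamK; positivity

/-- **(4.15), l = 0** (master form): `‖P_k^{(0)}(φ)‖ = λ_k(|φ|² − ρ₀²)² = P_k(φ)`. [cite: BalabanImbrieJaffe1988, (4.15) p.276] -/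
theorem norm_iteratedFDeriv_Pk_zero (hlam : 0 < lam) (hs : 0 < s) (d : ℕ) (z : ℂ) :
    ‖iteratedFDeriv ℝ 0 (BIJ88Sect4Statements.Pk (lamK lam s d) s lam d) z‖ =
      lamK lam s d * (‖z‖ ^ 2 - rho0 lam s d ^ 2) ^ 2 := by
  rw [Pk_eq_quartic hlam hs, (quartic_bounds _ _ z).1, abs_of_pos (lamK_pos hlam hs d)]

/-- **(4.15), l = 1** (master form): `‖P_k^{(1)}(φ)‖ ≤ 4λ_k·||φ|² − ρ₀²|·|φ|`. [cite: BalabanImbrieJaffe1988, (4.15) p.276] -/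
theorem norm_iteratedFDeriv_Pk_one_le (hlam : 0 < lam) (hs : 0 < s) (d : ℕ) (z : ℂ) :
    ‖iteratedFDeriv ℝ 1 (BIJ88Sect4Statements.Pk (lamK lam s d) s lam d) z‖ ≤
      4 * lamK lam s d * |‖z‖ ^ 2 - rho0 lam s d ^ 2| * ‖z‖ := by
  rw [Pk_eq_quartic hlam hs]
  simpa only [abs_of_pos (lamK_pos hlam hs d)] using (quartic_bounds (lamK lam s d) (rho0 lam s d ^ 2) z).2.1

/-- **(4.15), l = 2** (master form): `‖P_k^{(2)}(φ)‖ ≤ λ_k(4||φ|² − ρ₀²| + 8|φ|²)`. [cite: BalabanImbrieJaffe1988, (4.15) p.276] -/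
theorem norm_iteratedFDeriv_Pk_two_le (hlam : 0 < lam) (hs : 0 < s) (d : ℕ) (z : ℂ) :
    ‖iteratedFDeriv ℝ 2 (BIJ88Sect4Statements.Pk (lamK lam s d) s lam d) z‖ ≤
      lamK lam s d * (4 * |‖z‖ ^ 2 - rho0 lam s d ^ 2| + 8 * ‖z‖ ^ 2) := by
  rw [Pk_eq_quartic hlam hs]
  simpa only [abs_of_pos (lamK_pos hlam hs d)] using (quartic_bounds (lamK lam s d) (rho0 lam s d ^ 2) z).2.2.1

/-- **(4.15), l = 3** (master form): `‖P_k^{(3)}(φ)‖ ≤ 24λ_k|φ|`. [cite: BalabanImbrieJaffe1988, (4.15) p.276] -/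
theorem norm_iteratedFDeriv_Pk_three_le (hlam : 0 < lam) (hs : 0 < s) (d : ℕ) (z : ℂ) :
    ‖iteratedFDeriv ℝ 3 (BIJ88Sect4Statements.Pk (lamK lam s d) s lam d) z‖ ≤ 24 * lamK lam s d * ‖z‖ := by
  rw [Pk_eq_quartic hlam hs]
  simpa only [abs_of_pos (lamK_pos hlam hs d)] using (quartic_bounds (lamK lam s d) (rho0 lam s d ^ 2) z).2.2.2.1

/-- **(4.15), l = 4** (master form): `‖P_k^{(4)}(φ)‖ ≤ 24λ_k`. [cite: BalabanImbrieJaffe1988, (4.15) p.276] -/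
theorem norm_iteratedFDeriv_Pk_four_le (hlam : 0 < lam) (hs : 0 < s) (d : ℕ) (z : ℂ) :
    ‖iteratedFDeriv ℝ 4 (BIJ88Sect4Statements.Pk (lamK lam s d) s lam d) z‖ ≤ 24 * lamK lam s d := by
  rw [Pk_eq_quartic hlam hs]
  simpa only [abs_of_pos (lamK_pos hlam hs d)] using (quartic_bounds (lamK lam s d) (rho0 lam s d ^ 2) z).2.2.2.2.1

/-- **(4.15), l ≥ 5**: `P_k` is a polynomial of degree four in the two real components of `φ`, so `P_k^{(l)} = 0`.
[cite: BalabanImbrieJaffe1988, (4.15) p.276] -/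
theorem iteratedFDeriv_Pk_eq_zero (hlam : 0 < lam) (hs : 0 < s) (d : ℕ) (z : ℂ) {l : ℕ} (hl : 5 ≤ l) :
    iteratedFDeriv ℝ l (BIJ88Sect4Statements.Pk (lamK lam s d) s lam d) z = 0 := by
  rw [Pk_eq_quartic hlam hs]
  exact (quartic_bounds _ _ z).2.2.2.2.2 l hl

/-! ## §3. The regimes: `λ_k ≷ (L^kε)⁴ ⟺ λ ≷ (L^kε)^d`, and the ring radius -/

/-- kernel: `λ_k·s^d = s⁴·λ` (`λ_k = s^{4−d}λ`). [cite: BalabanImbrieJaffe1988, (4.15) p.276] -/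
theorem lamK_mul_pow (hs : 0 < s) (lam : ℝ) (d : ℕ) : lamK lam s d * s ^ d = s ^ 4 * lam := by
  unfold lamK
  have h : s ^ ((4 : ℤ) - d) * s ^ (d : ℤ) = s ^ (4 : ℤ) := by
    rw [← zpow_add₀ hs.ne']; congr 1; ring
  rw [← zpow_natCast s d, mul_right_comm, h]
  norm_cast

/-- kernel: `s^d ≤ λ ⟺ s⁴ ≤ λ_k`. [cite: BalabanImbrieJaffe1988, (4.15) p.276] -/
theorem pow_le_iff_pow_four_le_lamK (hs : 0 < s) (lam : ℝ) (d : ℕ) :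
    s ^ d ≤ lam ↔ s ^ 4 ≤ lamK lam s d := by
  have hsd : 0 < s ^ d := pow_pos hs d
  have h := lamK_mul_pow hs lam d
  constructor
  · intro hle
    have : s ^ 4 * s ^ d ≤ lamK lam s d * s ^ d := by rw [h]; gcongr
    exact le_of_mul_le_mul_right this hsd
  · intro hle
    have : s ^ 4 * s ^ d ≤ s ^ 4 * lam := by
      calc s ^ 4 * s ^ d ≤ lamK lam s d * s ^ d := mul_le_mul_of_nonneg_right hle hsd.le
        _ = s ^ 4 * lam := h
    exact le_of_mul_le_mul_left this (pow_pos hs 4)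

/-- kernel: `λ ≤ s^d ⟺ λ_k ≤ s⁴`. [cite: BalabanImbrieJaffe1988, (4.15) p.276] -/
theorem le_pow_iff_lamK_le_pow_four (hs : 0 < s) (lam : ℝ) (d : ℕ) :
    lam ≤ s ^ d ↔ lamK lam s d ≤ s ^ 4 := by
  have hsd : 0 < s ^ d := pow_pos hs d
  have h := lamK_mul_pow hs lam d
  constructor
  · intro hle
    have : lamK lam s d * s ^ d ≤ s ^ 4 * s ^ d := by rw [h]; gcongr
    exact le_of_mul_le_mul_right this hsd
  · intro hle
    have : s ^ 4 * lam ≤ s ^ 4 * s ^ d := by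
      calc s ^ 4 * lam = lamK lam s d * s ^ d := h.symm
        _ ≤ s ^ 4 * s ^ d := mul_le_mul_of_nonneg_right hle hsd.le
    exact le_of_mul_le_mul_left this (pow_pos hs 4)

/-- kernel: `λ < s^d ⟺ λ_k < s⁴`. [cite: BalabanImbrieJaffe1988, (4.15) p.276] -/
theorem lt_pow_iff_lamK_lt_pow_four (hs : 0 < s) (lam : ℝ) (d : ℕ) :
    lam < s ^ d ↔ lamK lam s d < s ^ 4 := by
  rw [← not_le, ← not_le, pow_le_iff_pow_four_le_lamK hs]

/-- kernel: the small-field regime of (4.5), `s^d < L^dλ`, is `s⁴ < L^dλ_k`. [cite: BalabanImbrieJaffe1988, (4.15) p.276] -/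
theorem pow_four_lt_of_smallField (hs : 0 < s) {L : ℝ} (lam : ℝ) (d : ℕ) (h : s ^ d < L ^ d * lam) :
    s ^ 4 < L ^ d * lamK lam s d := by
  have hsd : 0 < s ^ d := pow_pos hs d
  have h' := lamK_mul_pow hs lam d
  have : s ^ 4 * s ^ d < L ^ d * lamK lam s d * s ^ d := by
    calc s ^ 4 * s ^ d < s ^ 4 * (L ^ d * lam) := mul_lt_mul_of_pos_left h (pow_pos hs 4)
      _ = L ^ d * (s ^ 4 * lam) := by ring
      _ = L ^ d * (lamK lam s d * s ^ d) := by rw [h']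
      _ = L ^ d * lamK lam s d * s ^ d := by ring
  exact lt_of_mul_lt_mul_right this hsd.le

/-- kernel: r18's typing of the ring radius of (4.5), `(8λ)^{−1/2}s^{(d−2)/2}`, is r16's `ρ₀ = √(s^{d−2}/(8λ))` of (5.2.5).
[cite: BalabanImbrieJaffe1988, (4.15) p.276] -/
theorem ringRadius_eq_rho0 (hlam : 0 < lam) (hs : 0 < s) (d : ℕ) :
    (8 * lam) ^ (-(1 / 2 : ℝ)) * s ^ (((d : ℝ) - 2) / 2) = rho0 lam s d := by
  have h8 : (0 : ℝ) < 8 * lam := by positivity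
  have hL : 0 ≤ (8 * lam) ^ (-(1 / 2 : ℝ)) * s ^ (((d : ℝ) - 2) / 2) := by positivity
  have hR : 0 ≤ rho0 lam s d := Real.sqrt_nonneg _
  rw [← sq_eq_sq₀ hL hR, rho0_sq hlam hs, mul_pow, ← Real.rpow_natCast ((8 * lam) ^ (-(1 / 2 : ℝ))) 2,
    ← Real.rpow_mul h8.le, ← Real.rpow_natCast (s ^ (((d : ℝ) - 2) / 2)) 2, ← Real.rpow_mul hs.le,
    show (-(1 / 2 : ℝ)) * ((2 : ℕ) : ℝ) = -1 by norm_num,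
    show ((d : ℝ) - 2) / 2 * ((2 : ℕ) : ℝ) = (((d : ℤ) - 2 : ℤ) : ℝ) by push_cast; ring,
    Real.rpow_intCast, Real.rpow_neg_one]
  field_simp

/-- kernel: `λ_kρ₀ ≤ 3s³/8` in the large-field regime `λ_k ≤ s⁴` (from `λ_kρ₀² = s²/8` and `ρ₀ ≥ (8^{1/2}s)⁻¹ > (3s)⁻¹`).
[cite: BalabanImbrieJaffe1988, (4.15) p.276] -/
theorem lamK_mul_rho0_le (hlam : 0 < lam) (hs : 0 < s) (d : ℕ) (hΛ : lamK lam s d ≤ s ^ 4) :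
    lamK lam s d * rho0 lam s d ≤ 3 * s ^ 3 / 8 := by
  have hΛpos := lamK_pos hlam hs d
  have hρ : 0 ≤ rho0 lam s d := Real.sqrt_nonneg _
  have hkey := lamK_mul_rho0_sq hlam hs d
  -- (3 s ρ₀)² ≥ 9/8 > 1, hence 1 ≤ 3 s ρ₀
  have h1 : 1 ≤ 3 * s * rho0 lam s d := by
    by_contra hlt
    have hlt' : 3 * s * rho0 lam s d < 1 := not_le.mp hlt
    have hsq : (3 * s * rho0 lam s d) ^ 2 < 1 := by
      calc (3 * s * rho0 lam s d) ^ 2 < 1 ^ 2 := by gcongr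
        _ = 1 := one_pow 2
    -- but λ_k (3 s ρ₀)² = 9 s² λ_k ρ₀² = 9 s⁴/8 > λ_k
    have : lamK lam s d * (3 * s * rho0 lam s d) ^ 2 = 9 * s ^ 4 / 8 := by
      rw [show lamK lam s d * (3 * s * rho0 lam s d) ^ 2 = 9 * s ^ 2 * (lamK lam s d * rho0 lam s d ^ 2) by ring, hkey]
      ring
    nlinarith [mul_lt_mul_of_pos_left hsq hΛpos, pow_pos hs 4]
  calc lamK lam s d * rho0 lam s d = lamK lam s d * rho0 lam s d * 1 := (mul_one _).symm
    _ ≤ lamK lam s d * rho0 lam s d * (3 * s * rho0 lam s d) := by gcongr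
    _ = 3 * s * (lamK lam s d * rho0 lam s d ^ 2) := by ring
    _ = 3 * s ^ 3 / 8 := by rw [hkey]; ring

end

end Literature.MathematicalPhysics.QuantumFieldTheory.BalabanImbrieJaffe1984to88.BIJ88PkDerivatives
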